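import Summits.Ventures.PercRepro2.TypedCountMonotoneNeg

/-!
# Monotonicity off the source — statement (MN) — is false: the pendant-bundle source gadget
(blind cell PercRepro2, night-3 g26, 2026-08-29; `proofs/NIGHT3-CERT.md` §35)

§34.12 recorded **(MN)** — `T(H) ≥ T(H − e)` for every edge `e` NOT at the source `s` — as the one
local statement of the line surviving every exhaustive tensor-cone census (187,900 / 187,900
non-source edge instances, `n ≤ 7`), and `TypedCountStar.typedCount_nonneg_of_mono_off_source`
reduces `T ≥ 0` to it.  **(MN) is false**, by a transfer principle: join a NEW source `s'` to the old
source `s` by a bundle of `k` parallel edges (`f, g` blind to `s'`).  Exactly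
`T(H') = P(H) + (2^k − 2)·T(H)` with `P(H) = Σ_{A : v ∈ R_A} (f(R_A) − f(∅))(g(R_A) − g(∅)) ≥ 0`
(bundle all red: the blue cluster of `s'` is `{s'}`; all blue: weight `0`; mixed: the clusters of
`H` joined with `s'`), so `T(H') − T(H' − e) = [P(H) − P(H − e)] + (2^k − 2)·[T(H) − T(H − e)]`, and
every edge of `H` is off the new source.  Hence (MN) for all multigraphs would force
`T(H) ≥ T(H − e)` at EVERY edge (`k → ∞`), which §34.11 refutes at edges at `s`.

Witness (the kernel instance below): `H = K_{2,3}` with parts `{0, 1}` and `{2, 3, 4}`, `s = 0`,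
`v = 1`, `f = [2 ∈ ·]`, `g = [{3, 4} ⊆ ·]`: `T(H) = 3 < T(H − e) = 5` at `e = (0, 2)`, with
`P(H) = 19`, `P(H − e) = 5`; the bundle `k = 4` from `s' = 5` gives `T(H') = 19 + 14·3 = 61` and
`T(H' − e) = 5 + 14·5 = 75` — `e = (0, 2)` is not at `s' = 5`.  Both counts are nonnegative; only the
monotonicity fails.  (Exact Python re-check: `mining/night-3/g26/tcount.py`.)  Own work; standard
axioms.
-/

namespace Summit.Ventures.PercRepro2

namespace TypedCert

/-- `T(H') = 61` on the gadget witness (`K_{2,3}` plus a 4-fold bundle `(5, 0)`; `s = 5`, `v = 1`). -/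
theorem Tform_offSourceWitness_eq :
    Tform [(5, 0), (5, 0), (5, 0), (5, 0), (0, 2), (0, 3), (0, 4), (1, 2), (1, 3), (1, 4)] 5 1
      (fun X : Nat => if X.testBit 2 then (1 : ℚ) else 0)
      (fun X : Nat => if X &&& 24 = 24 then (1 : ℚ) else 0) = 61 := by
  decide +kernel

/-- `T(H' − e) = 75` on the gadget witness, `e = (0, 2)` (not at the source `5`). -/
theorem Tform_offSourceWitness_erase_eq :
    Tform [(5, 0), (5, 0), (5, 0), (5, 0), (0, 3), (0, 4), (1, 2), (1, 3), (1, 4)] 5 1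
      (fun X : Nat => if X.testBit 2 then (1 : ℚ) else 0)
      (fun X : Nat => if X &&& 24 = 24 then (1 : ℚ) else 0) = 75 := by
  decide +kernel

/-- **(MN) fails**: there are mask-monotone `f, g` and a multigraph with an edge `e` NOT at the
source such that `T(H) < T(H − e)`. -/
theorem exists_typedCount_lt_erase_off_source :
    ∃ f g : Nat → ℚ, MonoMask f ∧ MonoMask g ∧
      Tform [(5, 0), (5, 0), (5, 0), (5, 0), (0, 2), (0, 3), (0, 4), (1, 2), (1, 3), (1, 4)] 5 1 f g <
        Tform [(5, 0), (5, 0), (5, 0), (5, 0), (0, 3), (0, 4), (1, 2), (1, 3), (1, 4)] 5 1 f g :=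
  ⟨_, _, monoMask_indicator' 2, monoMask_indicator_subset' 24, by
    rw [Tform_offSourceWitness_eq, Tform_offSourceWitness_erase_eq]; norm_num⟩

end TypedCert

end Summit.Ventures.PercRepro2
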